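import Mathlib.MeasureTheory.Integral.IntervalIntegral.Basic
import Literature.Analysis.FluidPDE.HardSphereTimeScaling
import HarnessLib

/-!
# Thermal scaling of hard-sphere trajectories (helper, layer 1: deterministic)

Crux `Summit.AtomisticToContinuum.HydrodynamicLimit.Theses.AntiMazurCoboundaries.KineticWindowGronwall`
(stmt-AtomisticToContinuum-9282), line `dlr-block-transfer` v4, helper toward the lead's stub `stub_blockTransfer`
(proof-plan step (1): "thermal scaling `(x, t) ↦ (x, t√θ)`, `v ↦ v/√θ` reduces every use of the kinetic hypothesis
to the frame `θ = 1`") and toward the shared crux stmt-10967 (`∀ θ` ⇐ `θ = 1`).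

THE SYMMETRY. The hard-sphere dynamics has no intrinsic time scale: for `c > 0` the TIME–VELOCITY RESCALED curve
`γ_c t := scaleVel c (γ (c * t))` (positions unchanged, velocities multiplied by `c`, time compressed by `c`; this is
the tree's `timeDilate c γ`, `Literature.Analysis.FluidPDE.HardSphereTimeScaling`) of a hard-sphere trajectory `γ` is
again a hard-sphere trajectory for the SAME geometry and diameter (`IsHardSphereTrajectory.timeDilate`: free flight
commutes with the rescaling, contact only sees positions, the elastic law is homogeneous of degree one in the
velocities, incoming pairs stay incoming, left limits rescale). The THERMAL scaling of the block transfer is the case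
`c = (√θ)⁻¹`: `v ↦ v/√θ`, `t ↦ t√θ`, energy `E ↦ E/θ` — it carries the temperature-`θ` frame to the frame `θ = 1`.

CONTENTS (all deterministic, general geometry `G : Geometry d X`):
* registered helper stub `stub_trajectoryThermalScaling : TrajectoryThermalScaling` — closure of hard-sphere
  trajectories under `γ ↦ (t ↦ scaleVel c (γ (c t)))`, `c > 0`;
* the group law of the rescaling (`timeDilate_mul`, `timeDilate_inv_timeDilate`), the image form of the collision
  times (`collisionTimes_timeDilate_eq_image`), the change of variables in window time-averages
  (`intervalIntegral_comp_timeDilate`: `∫_a^b F (γ_c s) ds = c⁻¹ ∫_{ca}^{cb} F (scaleVel c (γ s)) ds`);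
* the thermal frame `thermalDilate θ γ := timeDilate (√θ)⁻¹ γ`: `IsHardSphereTrajectory.thermalDilate`,
  `configEnergy_thermalDilate` (`E ↦ θ⁻¹ E`), `thermalDilate_one`.
-/

noncomputable section

open Set Filter Function MeasureTheory
open Literature.Analysis.FluidPDE

namespace Summit.AtomisticToContinuum.HydrodynamicLimit.Theorems.KineticWindowGronwallThermalScaling

/-- **THERMAL (TIME–VELOCITY) SCALING OF HARD-SPHERE TRAJECTORIES.** For every geometry `G` on a position space `X`,
diameter `ε`, particle number `N`, curve `γ : ℝ → Config N d X` and `c > 0`: if `γ` is a hard-sphere trajectory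
(`IsHardSphereTrajectory G ε N γ`) then so is the rescaled curve `t ↦ scaleVel c (γ (c * t))` (positions unchanged,
velocities multiplied by `c`, time compressed by `c`). Folklore (dimensional analysis of the hard-sphere dynamics;
Serre 2024 §5, GST 2013 §4.1). -/
def TrajectoryThermalScaling : Prop :=
  ∀ {d : Type*} [Fintype d] {X : Type*} [TopologicalSpace X] (G : Geometry d X) (ε : ℝ) (N : ℕ)
    (γ : ℝ → Config N d X) (c : ℝ), 0 < c → IsHardSphereTrajectory G ε N γ →
    IsHardSphereTrajectory G ε N (fun t => scaleVel c (γ (c * t)))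

/-- **Layer 1, proved**: `stub_trajectoryThermalScaling` (the tree's `IsHardSphereTrajectory.timeDilate`, whose
`timeDilate c γ` is by definition `fun t => scaleVel c (γ (c * t))`). [folklore] -/
theorem stub_trajectoryThermalScaling : TrajectoryThermalScaling := by
  intro d _ X _ G ε N γ c hc h
  exact h.timeDilate hc

section Kinetic

variable {d : Type*} [Fintype d] {X : Type*} {N : ℕ}

/-! ### Group law of the rescaling -/

omit [Fintype d] in
/-- Rescalings compose multiplicatively: `(γ_b)_a = γ_{b a}` — `scaleVel a (scaleVel b z) = scaleVel (a b) z` and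
`b (a s) = (b a) s`… with the factors in the order `timeDilate a (timeDilate b γ) = timeDilate (a * b) γ`. [folklore] -/
theorem timeDilate_mul (a b : ℝ) (γ : ℝ → Config N d X) :
    timeDilate a (timeDilate b γ) = timeDilate (a * b) γ := by
  funext s
  simp only [timeDilate_apply, scaleVel_scaleVel, mul_assoc, mul_left_comm b a s]

omit [Fintype d] in
/-- `timeDilate c⁻¹` undoes `timeDilate c` (`c ≠ 0`). [folklore] -/
theorem timeDilate_inv_timeDilate {c : ℝ} (hc : c ≠ 0) (γ : ℝ → Config N d X) :
    timeDilate c⁻¹ (timeDilate c γ) = γ := by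
  rw [timeDilate_mul, inv_mul_cancel₀ hc, timeDilate_one]

omit [Fintype d] in
/-- `timeDilate c` undoes `timeDilate c⁻¹` (`c ≠ 0`). [folklore] -/
theorem timeDilate_timeDilate_inv {c : ℝ} (hc : c ≠ 0) (γ : ℝ → Config N d X) :
    timeDilate c (timeDilate c⁻¹ γ) = γ := by
  rw [timeDilate_mul, mul_inv_cancel₀ hc, timeDilate_one]

omit [Fintype d] in
/-- The rescaling is injective on curves (`c ≠ 0`). [folklore] -/
theorem timeDilate_injective {c : ℝ} (hc : c ≠ 0) :
    Function.Injective (timeDilate c : (ℝ → Config N d X) → ℝ → Config N d X) := fun γ γ' h => by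
  rw [← timeDilate_inv_timeDilate hc γ, h, timeDilate_inv_timeDilate hc]

/-! ### Collision times and window time-averages of the rescaled curve -/

variable {G : Geometry d X}

/-- Image form of the collision times of the rescaled curve: `C(γ_c) = c⁻¹ · C(γ)` (`c ≠ 0`; the tree's
`collisionTimes_timeDilate` is the preimage form `(c ·)⁻¹' C(γ)`). [folklore] -/
theorem collisionTimes_timeDilate_eq_image {c : ℝ} (hc : c ≠ 0) (ε : ℝ) (γ : ℝ → Config N d X) :
    collisionTimes G ε (timeDilate c γ) = (fun t => c⁻¹ * t) '' collisionTimes G ε γ := by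
  rw [collisionTimes_timeDilate]
  ext s
  simp only [mem_preimage, mem_image]
  constructor
  · intro hs
    exact ⟨c * s, hs, by rw [inv_mul_cancel_left₀ hc]⟩
  · rintro ⟨t, ht, rfl⟩
    rwa [mul_inv_cancel_left₀ hc]

/-- A time is a collision time of `γ` iff its rescaling `c⁻¹ t` is one of `γ_c`. [folklore] -/
theorem inv_mul_mem_collisionTimes_timeDilate_iff {c : ℝ} (hc : c ≠ 0) (ε : ℝ) (γ : ℝ → Config N d X)
    (t : ℝ) : c⁻¹ * t ∈ collisionTimes G ε (timeDilate c γ) ↔ t ∈ collisionTimes G ε γ := by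
  rw [collisionTimes_timeDilate, mem_preimage, mul_inv_cancel_left₀ hc]

omit [Fintype d] in
/-- **Change of variables in window time-averages**: for any observable `F` of the configuration,
`∫_a^b F (γ_c s) ds = c⁻¹ ∫_{ca}^{cb} F (scaleVel c (γ s)) ds` (the kinetic window functional of the rescaled
curve over a window of length `τ` is the rescaled-observable functional of `γ` over the window `c τ`). [folklore] -/
theorem intervalIntegral_comp_timeDilate {E : Type*} [NormedAddCommGroup E] [NormedSpace ℝ E] {c : ℝ}
    (hc : c ≠ 0) (γ : ℝ → Config N d X) (F : Config N d X → E) (a b : ℝ) :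
    ∫ s in a..b, F (timeDilate c γ s) = c⁻¹ • ∫ s in (c * a)..(c * b), F (scaleVel c (γ s)) := by
  simp only [timeDilate_apply]
  exact intervalIntegral.integral_comp_mul_left (fun s => F (scaleVel c (γ s))) hc

omit [Fintype d] in
/-- Window averages are invariant in the matched windows: `(b - a)⁻¹ ∫_a^b F (γ_c s) ds =
(cb - ca)⁻¹ ∫_{ca}^{cb} F (scaleVel c (γ s)) ds` (`c ≠ 0`). [folklore] -/
theorem windowAverage_comp_timeDilate {c : ℝ} (hc : c ≠ 0) (γ : ℝ → Config N d X) (F : Config N d X → ℝ)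
    (a b : ℝ) :
    (b - a)⁻¹ * ∫ s in a..b, F (timeDilate c γ s) =
      (c * b - c * a)⁻¹ * ∫ s in (c * a)..(c * b), F (scaleVel c (γ s)) := by
  rw [intervalIntegral_comp_timeDilate hc, smul_eq_mul, ← mul_sub, mul_inv, ← mul_assoc, mul_comm (b - a)⁻¹]

/-! ### The thermal frame `c = (√θ)⁻¹` -/

omit [Fintype d] in
/-- The THERMAL RESCALING to unit temperature: `v ↦ v / √θ`, `t ↦ t √θ`, i.e. `timeDilate (√θ)⁻¹`:
`(thermalDilate θ γ) t = scaleVel (√θ)⁻¹ (γ ((√θ)⁻¹ * t))`. -/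
def thermalDilate (θ : ℝ) (γ : ℝ → Config N d X) : ℝ → Config N d X :=
  timeDilate (Real.sqrt θ)⁻¹ γ

omit [Fintype d] in
/-- Unfolding lemma for `thermalDilate`. [folklore] -/
@[simp]
theorem thermalDilate_apply (θ : ℝ) (γ : ℝ → Config N d X) (t : ℝ) :
    thermalDilate θ γ t = scaleVel (Real.sqrt θ)⁻¹ (γ ((Real.sqrt θ)⁻¹ * t)) := rfl

omit [Fintype d] in
/-- `thermalDilate θ = timeDilate (√θ)⁻¹`. [folklore] -/
theorem thermalDilate_eq_timeDilate (θ : ℝ) (γ : ℝ → Config N d X) :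
    thermalDilate θ γ = timeDilate (Real.sqrt θ)⁻¹ γ := rfl

omit [Fintype d] in
/-- At unit temperature the thermal rescaling does nothing. [folklore] -/
@[simp]
theorem thermalDilate_one (γ : ℝ → Config N d X) : thermalDilate 1 γ = γ := by
  rw [thermalDilate_eq_timeDilate, Real.sqrt_one, inv_one, timeDilate_one]

/-- The thermal scaling factor `(√θ)⁻¹` is positive for `θ > 0`. [folklore] -/
theorem inv_sqrt_pos {θ : ℝ} (hθ : 0 < θ) : 0 < (Real.sqrt θ)⁻¹ :=
  inv_pos.2 (Real.sqrt_pos.2 hθ)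

/-- **The thermal rescaling of a hard-sphere trajectory is a hard-sphere trajectory** (`θ > 0`). [folklore] -/
theorem IsHardSphereTrajectory.thermalDilate [TopologicalSpace X] {ε : ℝ} {γ : ℝ → Config N d X}
    (h : IsHardSphereTrajectory G ε N γ) {θ : ℝ} (hθ : 0 < θ) :
    IsHardSphereTrajectory G ε N (thermalDilate θ γ) :=
  h.timeDilate (inv_sqrt_pos hθ)

/-- The kinetic energy in the thermal frame: `E((thermalDilate θ γ) t) = θ⁻¹ E(γ (t/√θ))` (`0 ≤ θ`). [folklore] -/
theorem configEnergy_thermalDilate {θ : ℝ} (hθ : 0 ≤ θ) (γ : ℝ → Config N d X) (t : ℝ) :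
    configEnergy (thermalDilate θ γ t) = θ⁻¹ * configEnergy (γ ((Real.sqrt θ)⁻¹ * t)) := by
  rw [thermalDilate_eq_timeDilate, configEnergy_timeDilate, inv_pow, Real.sq_sqrt hθ]

/-- The velocity scaling of the thermal frame squares to the inverse temperature:
`configEnergy (scaleVel (√θ)⁻¹ z) = θ⁻¹ configEnergy z` (`0 ≤ θ`). [folklore] -/
theorem configEnergy_scaleVel_inv_sqrt {θ : ℝ} (hθ : 0 ≤ θ) (z : Config N d X) :
    configEnergy (scaleVel (Real.sqrt θ)⁻¹ z) = θ⁻¹ * configEnergy z := by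
  rw [configEnergy_scaleVel, inv_pow, Real.sq_sqrt hθ]

/-- The number of collisions in the thermal frame: `#C(thermalDilate θ γ) ∩ [a, b] = #C(γ) ∩ [a/√θ, b/√θ]`
(`θ > 0`). [folklore] -/
theorem numCollisions_thermalDilate {θ : ℝ} (hθ : 0 < θ) (ε : ℝ) (γ : ℝ → Config N d X) (a b : ℝ) :
    numCollisions G ε (thermalDilate θ γ) a b =
      numCollisions G ε γ ((Real.sqrt θ)⁻¹ * a) ((Real.sqrt θ)⁻¹ * b) := by
  rw [thermalDilate_eq_timeDilate, numCollisions_timeDilate (inv_sqrt_pos hθ)]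

omit [Fintype d] in
/-- Undoing the thermal rescaling: `timeDilate √θ (thermalDilate θ γ) = γ` (`θ > 0`). [folklore] -/
theorem timeDilate_sqrt_thermalDilate {θ : ℝ} (hθ : 0 < θ) (γ : ℝ → Config N d X) :
    timeDilate (Real.sqrt θ) (thermalDilate θ γ) = γ := by
  rw [thermalDilate_eq_timeDilate, timeDilate_timeDilate_inv (Real.sqrt_pos.2 hθ).ne']

end Kinetic

end Summit.AtomisticToContinuum.HydrodynamicLimit.Theorems.KineticWindowGronwallThermalScaling

end
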